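import Summits.Ventures.LatticeQCDFlow.Exactness.FlowSamplerSymmetrisation
import HarnessLib

/-!
# SYMMETRISING A FLOW NEVER INCREASES EITHER KULLBACK–LEIBLER DIVERGENCE: the training loss `KL(q̃‖π)` and the coverage loss `KL(π‖q̃)` of `q̃ₛ = ½(q̃ + q̃∘σ)` are at most those of `q̃`

HONEST FRAMING: exact (Metropolis-corrected) sampling algorithms for lattice gauge theory;
figures of merit are autocorrelation/cost numbers at stated couplings and volumes; no
continuum-physics claim.  (SCALAR calibration rung S0-A: not a gauge result.)

Venture `LatticeQCDFlow` (cell pub-lqcd), topic `Exactness`; FANOUT row 2 (`s0-phi4`, FLOW arm).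
NEW WORK of the cell, companion of `FlowSamplerSymmetrisation` (acceptance, importance-weight moment,
sticking column).  Setting: s-finite `(X, μ)`, a measure-preserving involution `σ`, an even target
weight `w ∘ σ = w` (`w > 0`; the normalisation `Z = ∫ w` only shifts both divergences by the same
constant, so unnormalised integrands are compared), an arbitrary positive normalised model density `q̃`.
Joint convexity of `(a, b) ↦ a log(a/b)` in its first argument and concavity of `log` give, pointwise,
`q̃ₛ log(q̃ₛ/w) ≤ ½(q̃ log(q̃/w) + (q̃∘σ) log((q̃∘σ)/w))` and `w log(w/q̃ₛ) ≤ ½(w log(w/q̃) + w log(w/(q̃∘σ)))`;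
the `σ`-shifted halves integrate to the unshifted ones (`∫ F ∘ σ = ∫ F`, `w` even).

* `midpoint_mul_log_div_le` — the two-point convexity of `a ↦ a log(a/b)` (from `a − b ≤ a log(a/b)`,
  the tree's `1 − 1/y ≤ log y`, kept as a local step — the PneNP tree has it as `mul_log_div_ge`); `log_midpoint_ge` — `½(log a + log b) ≤ log((a + b)/2)`.
* **`symmetrised_reverseKL_le`** — `∫ q̃ log(q̃/w) ∈ L¹ ⇒ q̃ₛ log(q̃ₛ/w) ∈ L¹` and
  `∫ q̃ₛ log(q̃ₛ/w) ≤ ∫ q̃ log(q̃/w)`: the REVERSE KL — the self-sampling training loss of the flow, up to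
  `log Z` — never increases under symmetrisation;
* **`symmetrised_forwardKL_le`** — `w log(w/q̃) ∈ L¹ ⇒ w log(w/q̃ₛ) ∈ L¹` and
  `∫ w log(w/q̃ₛ) ≤ ∫ w log(w/q̃)`: the FORWARD KL (mode-coverage / maximum-likelihood loss, `Z·KL(π‖q̃)`
  up to `Z log Z`) never increases either;
* **`symmetrised_overlap_ge`** — `∫ min(w, q̃ₛ) ≥ ∫ min(w, q̃)`: the total-variation distance to the
  target never increases (so neither bound of `FlowAcceptanceOverlap`'s `m² ≤ ā ≤ m` degrades).

PRIOR ART NAMED (not cited as a fact): the symmetrised proposal is the 'single-model symmetrized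
mixture' of Boyda et al. 2021 / Hackett et al. 2021 §4.2 (`p̃_mix = |G|⁻¹ Σ_a p̃∘t_a⁻¹`); what is typed
here are guarantees for it.  IN THE TREE, NOT RESTATED: Tierney 1998 Prop. 5 / Liu 2001 Thm 13.3.4 —
a Metropolis kernel with a MIXTURE proposal Peskun-dominates the mixture of the kernels —
`Literature.Probability.MarkovChains.MixtureProposalPeskun` (finite state space).  NOT CLAIMED: strict improvement for any network; anything about the optimisation landscape of
symmetrised architectures; any value of a divergence for any run.  The inequalities are the classical
convexity of relative entropy (Kullback–Leibler; Cover–Thomas 'log-sum inequality') NAMED, not cited.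
-/

namespace Summit.Ventures.LatticeQCDFlow.Exactness

open Real MeasureTheory Filter Finset Set Topology
open Summit.Ventures.LatticeQCDFlow.Scoring

/-! ## §0 Scalar inequalities for `a log(a/b)` and `log` -/

/-- Two-point convexity of `a ↦ a log(a/b)`: for `a₁, a₂, b > 0`,
`((a₁ + a₂)/2) log(((a₁ + a₂)/2)/b) ≤ (a₁ log(a₁/b) + a₂ log(a₂/b))/2`. -/
theorem midpoint_mul_log_div_le {a₁ a₂ b : ℝ} (h1 : 0 < a₁) (h2 : 0 < a₂) (hb : 0 < b) :
    (a₁ + a₂) / 2 * Real.log ((a₁ + a₂) / 2 / b)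
      ≤ (a₁ * Real.log (a₁ / b) + a₂ * Real.log (a₂ / b)) / 2 := by
  have sub_le : ∀ {a b : ℝ}, 0 < a → 0 < b → a - b ≤ a * Real.log (a / b) := fun {a b} ha hb => by
    have h := Real.one_sub_inv_le_log_of_pos (div_pos ha hb)
    have e : a * (1 - (a / b)⁻¹) = a - b := by field_simp
    calc a - b = a * (1 - (a / b)⁻¹) := e.symm
      _ ≤ a * Real.log (a / b) := mul_le_mul_of_nonneg_left h ha.le
  set m := (a₁ + a₂) / 2 with hm
  have hm0 : 0 < m := by rw [hm]; positivity
  have k1 := sub_le h1 hm0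
  have k2 := sub_le h2 hm0
  rw [Real.log_div h1.ne' hm0.ne'] at k1
  rw [Real.log_div h2.ne' hm0.ne'] at k2
  rw [Real.log_div hm0.ne' hb.ne', Real.log_div h1.ne' hb.ne', Real.log_div h2.ne' hb.ne']
  have e : m = (a₁ + a₂) / 2 := hm
  -- linear in the atoms `aᵢ log aᵢ`, `aᵢ log m`, `aᵢ log b` once `m` is expanded
  have key : (a₁ * (Real.log a₁ - Real.log b) + a₂ * (Real.log a₂ - Real.log b)) / 2
      - m * (Real.log m - Real.log b)
      = (a₁ * (Real.log a₁ - Real.log m) + a₂ * (Real.log a₂ - Real.log m)) / 2 := by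
    rw [e]; ring
  nlinarith [key, k1, k2]

/-- Concavity of `log` at a midpoint: `(log a + log b)/2 ≤ log((a + b)/2)` for `a, b > 0`. -/
theorem log_midpoint_ge {a b : ℝ} (ha : 0 < a) (hb : 0 < b) :
    (Real.log a + Real.log b) / 2 ≤ Real.log ((a + b) / 2) := by
  have hab : 0 < a * b := mul_pos ha hb
  have hsq : a * b ≤ ((a + b) / 2) ^ 2 := by nlinarith [sq_nonneg (a - b)]
  have h := Real.log_le_log hab hsq
  rw [Real.log_mul ha.ne' hb.ne', Real.log_pow] at h
  push_cast at h
  linarith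

/-! ## §1 The two divergences under symmetrisation -/

section General

variable {X : Type*} [MeasurableSpace X] {μ : Measure X} [SFinite μ] {w q : X → ℝ} {σ : X → X}

omit [SFinite μ] in
/-- **THE REVERSE KL (TRAINING LOSS) NEVER INCREASES**: `σ` a measure-preserving involution,
`w ∘ σ = w`, `w, q̃ > 0` measurable, `q̃ ∈ L¹`; if `q̃ log(q̃/w) ∈ L¹` then `q̃ₛ log(q̃ₛ/w) ∈ L¹` and
`∫ q̃ₛ log(q̃ₛ/w) ≤ ∫ q̃ log(q̃/w)` (`q̃ₛ = ½(q̃ + q̃∘σ)`). -/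
theorem symmetrised_reverseKL_le (hσ : MeasurePreserving σ μ μ) (hσσ : ∀ x, σ (σ x) = x)
    (hw0 : ∀ t, 0 < w t) (hwm : Measurable w) (hwi : Integrable w μ) (hw : ∀ t, w (σ t) = w t)
    (hq0 : ∀ t, 0 < q t) (hqm : Measurable q) (hqi : Integrable q μ)
    (hKL : Integrable (fun x => q x * Real.log (q x / w x)) μ) :
    Integrable (fun x => (q x + q (σ x)) / 2 * Real.log ((q x + q (σ x)) / 2 / w x)) μ ∧
    ∫ x, (q x + q (σ x)) / 2 * Real.log ((q x + q (σ x)) / 2 / w x) ∂μ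
      ≤ ∫ x, q x * Real.log (q x / w x) ∂μ := by
  set F : X → ℝ := fun x => q x * Real.log (q x / w x) with hF
  have hFσ : Integrable (fun x => F (σ x)) μ := integrable_comp_involution hσ hσσ hKL
  have hFσ_eq : ∀ x, F (σ x) = q (σ x) * Real.log (q (σ x) / w x) := fun x => by
    show q (σ x) * Real.log (q (σ x) / w (σ x)) = q (σ x) * Real.log (q (σ x) / w x)
    rw [hw x]
  have hσint : ∫ x, F (σ x) ∂μ = ∫ x, F x ∂μ := integral_comp_involution hσ hσσ F
  have hqσ : Integrable (fun x => q (σ x)) μ := integrable_comp_involution hσ hσσ hqi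
  -- pointwise: lower bound `q̃ₛ − w`, upper bound `½(F + F∘σ)`
  have hup : ∀ x, (q x + q (σ x)) / 2 * Real.log ((q x + q (σ x)) / 2 / w x) ≤ (F x + F (σ x)) / 2 :=
    fun x => by
      rw [hFσ_eq x]
      exact midpoint_mul_log_div_le (hq0 x) (hq0 (σ x)) (hw0 x)
  have sub_le : ∀ {a b : ℝ}, 0 < a → 0 < b → a - b ≤ a * Real.log (a / b) := fun {a b} ha hb => by
    have h := Real.one_sub_inv_le_log_of_pos (div_pos ha hb)
    have e : a * (1 - (a / b)⁻¹) = a - b := by field_simp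
    calc a - b = a * (1 - (a / b)⁻¹) := e.symm
      _ ≤ a * Real.log (a / b) := mul_le_mul_of_nonneg_left h ha.le
  have hlo : ∀ x, (q x + q (σ x)) / 2 - w x ≤ (q x + q (σ x)) / 2 * Real.log ((q x + q (σ x)) / 2 / w x) :=
    fun x => sub_le (div_pos (add_pos (hq0 x) (hq0 _)) two_pos) (hw0 x)
  have hmeas : Measurable fun x => (q x + q (σ x)) / 2 * Real.log ((q x + q (σ x)) / 2 / w x) :=
    ((hqm.add (hqm.comp hσ.measurable)).div_const 2).mul
      (Real.measurable_log.comp (((hqm.add (hqm.comp hσ.measurable)).div_const 2).div hwm))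
  have hint : Integrable (fun x => (q x + q (σ x)) / 2 * Real.log ((q x + q (σ x)) / 2 / w x)) μ := by
    refine Integrable.mono' (((hKL.add hFσ).div_const 2).abs.add (((hqi.add hqσ).div_const 2).sub hwi).abs)
      hmeas.aestronglyMeasurable (Eventually.of_forall fun x => ?_)
    rw [Real.norm_eq_abs]
    have h1 := hup x
    have h2 := hlo x
    show |(q x + q (σ x)) / 2 * Real.log ((q x + q (σ x)) / 2 / w x)|
      ≤ |(F x + F (σ x)) / 2| + |(q x + q (σ x)) / 2 - w x|
    rcases le_or_gt 0 ((q x + q (σ x)) / 2 * Real.log ((q x + q (σ x)) / 2 / w x)) with h | h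
    · rw [abs_of_nonneg h]
      exact h1.trans ((le_abs_self _).trans (le_add_of_nonneg_right (abs_nonneg _)))
    · rw [abs_of_neg h]
      have : -((q x + q (σ x)) / 2 * Real.log ((q x + q (σ x)) / 2 / w x)) ≤ |(q x + q (σ x)) / 2 - w x| := by
        have := neg_abs_le ((q x + q (σ x)) / 2 - w x)
        linarith
      exact this.trans (le_add_of_nonneg_left (abs_nonneg _))
  refine ⟨hint, ?_⟩
  calc ∫ x, (q x + q (σ x)) / 2 * Real.log ((q x + q (σ x)) / 2 / w x) ∂μ
      ≤ ∫ x, (F x + F (σ x)) / 2 ∂μ := integral_mono hint ((hKL.add hFσ).div_const 2) hup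
    _ = ∫ x, F x ∂μ := by
        rw [integral_div, integral_add hKL hFσ, hσint]
        ring

omit [SFinite μ] in
/-- **THE FORWARD KL (COVERAGE LOSS) NEVER INCREASES**: same setting; if `w log(w/q̃) ∈ L¹` then
`w log(w/q̃ₛ) ∈ L¹` and `∫ w log(w/q̃ₛ) ≤ ∫ w log(w/q̃)` (pointwise `log q̃ₛ ≥ ½(log q̃ + log q̃∘σ)`). -/
theorem symmetrised_forwardKL_le (hσ : MeasurePreserving σ μ μ) (hσσ : ∀ x, σ (σ x) = x)
    (hw0 : ∀ t, 0 < w t) (hwm : Measurable w) (hwi : Integrable w μ) (hw : ∀ t, w (σ t) = w t)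
    (hq0 : ∀ t, 0 < q t) (hqm : Measurable q) (hqi : Integrable q μ)
    (hKL : Integrable (fun x => w x * Real.log (w x / q x)) μ) :
    Integrable (fun x => w x * Real.log (w x / ((q x + q (σ x)) / 2))) μ ∧
    ∫ x, w x * Real.log (w x / ((q x + q (σ x)) / 2)) ∂μ ≤ ∫ x, w x * Real.log (w x / q x) ∂μ := by
  set F : X → ℝ := fun x => w x * Real.log (w x / q x) with hF
  have hFσ : Integrable (fun x => F (σ x)) μ := integrable_comp_involution hσ hσσ hKL
  have hFσ_eq : ∀ x, F (σ x) = w x * Real.log (w x / q (σ x)) := fun x => by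
    show w (σ x) * Real.log (w (σ x) / q (σ x)) = w x * Real.log (w x / q (σ x))
    rw [hw x]
  have hσint : ∫ x, F (σ x) ∂μ = ∫ x, F x ∂μ := integral_comp_involution hσ hσσ F
  have hqσ : Integrable (fun x => q (σ x)) μ := integrable_comp_involution hσ hσσ hqi
  have hup : ∀ x, w x * Real.log (w x / ((q x + q (σ x)) / 2)) ≤ (F x + F (σ x)) / 2 := fun x => by
    rw [hFσ_eq x]
    show w x * Real.log (w x / ((q x + q (σ x)) / 2))
      ≤ (w x * Real.log (w x / q x) + w x * Real.log (w x / q (σ x))) / 2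
    have hs0 : 0 < (q x + q (σ x)) / 2 := div_pos (add_pos (hq0 x) (hq0 _)) two_pos
    rw [Real.log_div (hw0 x).ne' hs0.ne', Real.log_div (hw0 x).ne' (hq0 x).ne',
      Real.log_div (hw0 x).ne' (hq0 (σ x)).ne']
    have h := log_midpoint_ge (hq0 x) (hq0 (σ x))
    nlinarith [hw0 x, h]
  have sub_le : ∀ {a b : ℝ}, 0 < a → 0 < b → a - b ≤ a * Real.log (a / b) := fun {a b} ha hb => by
    have h := Real.one_sub_inv_le_log_of_pos (div_pos ha hb)
    have e : a * (1 - (a / b)⁻¹) = a - b := by field_simp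
    calc a - b = a * (1 - (a / b)⁻¹) := e.symm
      _ ≤ a * Real.log (a / b) := mul_le_mul_of_nonneg_left h ha.le
  have hlo : ∀ x, w x - (q x + q (σ x)) / 2 ≤ w x * Real.log (w x / ((q x + q (σ x)) / 2)) :=
    fun x => sub_le (hw0 x) (div_pos (add_pos (hq0 x) (hq0 _)) two_pos)
  have hmeas : Measurable fun x => w x * Real.log (w x / ((q x + q (σ x)) / 2)) :=
    hwm.mul (Real.measurable_log.comp (hwm.div ((hqm.add (hqm.comp hσ.measurable)).div_const 2)))
  have hint : Integrable (fun x => w x * Real.log (w x / ((q x + q (σ x)) / 2))) μ := by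
    refine Integrable.mono' (((hKL.add hFσ).div_const 2).abs.add ((hwi.sub ((hqi.add hqσ).div_const 2))).abs)
      hmeas.aestronglyMeasurable (Eventually.of_forall fun x => ?_)
    rw [Real.norm_eq_abs]
    have h1 := hup x
    have h2 := hlo x
    show |w x * Real.log (w x / ((q x + q (σ x)) / 2))|
      ≤ |(F x + F (σ x)) / 2| + |w x - (q x + q (σ x)) / 2|
    rcases le_or_gt 0 (w x * Real.log (w x / ((q x + q (σ x)) / 2))) with h | h
    · rw [abs_of_nonneg h]
      exact h1.trans ((le_abs_self _).trans (le_add_of_nonneg_right (abs_nonneg _)))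
    · rw [abs_of_neg h]
      have : -(w x * Real.log (w x / ((q x + q (σ x)) / 2))) ≤ |w x - (q x + q (σ x)) / 2| := by
        have := neg_abs_le (w x - (q x + q (σ x)) / 2)
        linarith
      exact this.trans (le_add_of_nonneg_left (abs_nonneg _))
  refine ⟨hint, ?_⟩
  calc ∫ x, w x * Real.log (w x / ((q x + q (σ x)) / 2)) ∂μ
      ≤ ∫ x, (F x + F (σ x)) / 2 ∂μ := integral_mono hint ((hKL.add hFσ).div_const 2) hup
    _ = ∫ x, F x ∂μ := by
        rw [integral_div, integral_add hKL hFσ, hσint]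
        ring

/-! ## §2 The overlap (total variation) -/

omit [SFinite μ] in
/-- **THE MODEL–TARGET OVERLAP NEVER DECREASES** (`TV(π, q̃ₛ) ≤ TV(π, q̃)`): with `m(q̃) = ∫ min(w, q̃)`
(`= Z − Z·TV` up to normalisation), `m(q̃ₛ) ≥ m(q̃)` — pointwise `min(w, ½(q̃ + q̃∘σ)) ≥ ½(min(w, q̃) +
min(w, q̃∘σ))` (`min(w, ·)` is concave) and `∫ F ∘ σ = ∫ F`.  With `FlowAcceptanceOverlap`
(`m² ≤ ā ≤ m`) this is a second route to 'acceptance certificates never degrade'. -/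
theorem symmetrised_overlap_ge (hσ : MeasurePreserving σ μ μ) (hσσ : ∀ x, σ (σ x) = x)
    (hw0 : ∀ t, 0 < w t) (hwm : Measurable w) (hw : ∀ t, w (σ t) = w t)
    (hq0 : ∀ t, 0 < q t) (hqm : Measurable q) (hqi : Integrable q μ) :
    ∫ x, min (w x) (q x) ∂μ ≤ ∫ x, min (w x) ((q x + q (σ x)) / 2) ∂μ := by
  have hqσ : Integrable (fun x => q (σ x)) μ := integrable_comp_involution hσ hσσ hqi
  have hmin : ∀ {f : X → ℝ}, (∀ x, 0 < f x) → Measurable f → Integrable f μ →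
      Integrable (fun x => min (w x) (f x)) μ := fun hf0 hfm hfi => by
    refine Integrable.mono' hfi (hwm.min hfm).aestronglyMeasurable (Eventually.of_forall fun x => ?_)
    rw [Real.norm_eq_abs, abs_of_nonneg (le_min (hw0 x).le (hf0 x).le)]
    exact min_le_right _ _
  have hI1 : Integrable (fun x => min (w x) (q x)) μ := hmin hq0 hqm hqi
  have hI2 : Integrable (fun x => min (w x) (q (σ x))) μ :=
    hmin (fun x => hq0 _) (hqm.comp hσ.measurable) hqσ
  have hIs : Integrable (fun x => min (w x) ((q x + q (σ x)) / 2)) μ :=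
    hmin (fun x => div_pos (add_pos (hq0 x) (hq0 _)) two_pos)
      ((hqm.add (hqm.comp hσ.measurable)).div_const 2) ((hqi.add hqσ).div_const 2)
  have hσint : ∫ x, min (w x) (q (σ x)) ∂μ = ∫ x, min (w x) (q x) ∂μ := by
    rw [← integral_comp_involution hσ hσσ (fun x => min (w x) (q x))]
    exact integral_congr_ae (Eventually.of_forall fun x => by simp only [hw])
  have hpt : ∀ x, (min (w x) (q x) + min (w x) (q (σ x))) / 2 ≤ min (w x) ((q x + q (σ x)) / 2) :=
    fun x => by
      have h := min_add_min_le_min_add (w x) (w x) (q x) (q (σ x))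
      have e : (w x + w x) / 2 = w x := by ring
      calc (min (w x) (q x) + min (w x) (q (σ x))) / 2 ≤ min (w x + w x) (q x + q (σ x)) / 2 :=
            div_le_div_of_nonneg_right h (by norm_num)
        _ = min ((w x + w x) / 2) ((q x + q (σ x)) / 2) :=
            (min_div_div_right (by norm_num : (0:ℝ) ≤ 2) _ _).symm
        _ = min (w x) ((q x + q (σ x)) / 2) := by rw [e]
  calc ∫ x, min (w x) (q x) ∂μ = (∫ x, min (w x) (q x) ∂μ + ∫ x, min (w x) (q (σ x)) ∂μ) / 2 := by
        rw [hσint]; ring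
    _ = ∫ x, (min (w x) (q x) + min (w x) (q (σ x))) / 2 ∂μ := by
        rw [integral_div, integral_add hI1 hI2]
    _ ≤ ∫ x, min (w x) ((q x + q (σ x)) / 2) ∂μ := integral_mono ((hI1.add hI2).div_const 2) hIs hpt

end General

/-! ## §3 The lattice: row 2's φ⁴ flow arm (`σ = (φ ↦ −φ)`, `w = e^{−S}` even) -/

section Lattice

variable {n : ℕ}

/-- **THE SYMMETRISED FLOW'S TRAINING LOSS IS NO LARGER** (every real `J`, `λ`, every positive
measurable `q̃ ∈ L¹`): `∫ q̃ log(q̃/e^{−S}) ∈ L¹ ⇒ ∫ q̃ₛ log(q̃ₛ/e^{−S}) ≤ ∫ q̃ log(q̃/e^{−S})`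
(reverse KL up to the common constant `log Z`). -/
theorem phi4FlowSym_reverseKL_le (J : Fin (n + 1) → Fin (n + 1) → ℝ) {lam : ℝ} (hlam : 0 < lam)
    {q : (Fin (n + 1) → ℝ) → ℝ} (hq0 : ∀ φ, 0 < q φ) (hqm : Measurable q) (hqi : Integrable q)
    (hKL : Integrable (fun φ => q φ * Real.log (q φ / gibbsWeight J lam φ))) :
    Integrable (fun φ : Fin (n + 1) → ℝ =>
      (q φ + q (-φ)) / 2 * Real.log ((q φ + q (-φ)) / 2 / gibbsWeight J lam φ)) ∧
    ∫ φ : Fin (n + 1) → ℝ, (q φ + q (-φ)) / 2 * Real.log ((q φ + q (-φ)) / 2 / gibbsWeight J lam φ)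
      ≤ ∫ φ, q φ * Real.log (q φ / gibbsWeight J lam φ) := by
  haveI := isNegInvariant_volume_pi (Λ := Fin (n + 1))
  exact symmetrised_reverseKL_le (μ := volume) (σ := fun ψ : Fin (n + 1) → ℝ => -ψ)
    (Measure.measurePreserving_neg volume) (fun φ => neg_neg φ) (fun φ => gibbsWeight_pos J lam φ)
    (continuous_gibbsWeight J lam).measurable (integrable_gibbsWeight hlam J)
    (fun φ => gibbsWeight_neg J lam φ) hq0 hqm hqi hKL

/-- **THE SYMMETRISED FLOW'S COVERAGE LOSS IS NO LARGER**: `e^{−S} log(e^{−S}/q̃) ∈ L¹ ⇒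
∫ e^{−S} log(e^{−S}/q̃ₛ) ≤ ∫ e^{−S} log(e^{−S}/q̃)` (forward KL times `Z`, up to `Z log Z`). -/
theorem phi4FlowSym_forwardKL_le (J : Fin (n + 1) → Fin (n + 1) → ℝ) {lam : ℝ} (hlam : 0 < lam)
    {q : (Fin (n + 1) → ℝ) → ℝ} (hq0 : ∀ φ, 0 < q φ) (hqm : Measurable q) (hqi : Integrable q)
    (hKL : Integrable (fun φ => gibbsWeight J lam φ * Real.log (gibbsWeight J lam φ / q φ))) :
    Integrable (fun φ : Fin (n + 1) → ℝ =>
      gibbsWeight J lam φ * Real.log (gibbsWeight J lam φ / ((q φ + q (-φ)) / 2))) ∧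
    ∫ φ : Fin (n + 1) → ℝ, gibbsWeight J lam φ * Real.log (gibbsWeight J lam φ / ((q φ + q (-φ)) / 2))
      ≤ ∫ φ, gibbsWeight J lam φ * Real.log (gibbsWeight J lam φ / q φ) := by
  haveI := isNegInvariant_volume_pi (Λ := Fin (n + 1))
  exact symmetrised_forwardKL_le (μ := volume) (σ := fun ψ : Fin (n + 1) → ℝ => -ψ)
    (Measure.measurePreserving_neg volume) (fun φ => neg_neg φ) (fun φ => gibbsWeight_pos J lam φ)
    (continuous_gibbsWeight J lam).measurable (integrable_gibbsWeight hlam J)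
    (fun φ => gibbsWeight_neg J lam φ) hq0 hqm hqi hKL

/-- **THE SYMMETRISED FLOW'S OVERLAP WITH THE TARGET IS NO SMALLER**:
`∫ min(e^{−S}, q̃) ≤ ∫ min(e^{−S}, q̃ₛ)` (every real `J`, `λ`). -/
theorem phi4FlowSym_overlap_ge (J : Fin (n + 1) → Fin (n + 1) → ℝ) (lam : ℝ)
    {q : (Fin (n + 1) → ℝ) → ℝ} (hq0 : ∀ φ, 0 < q φ) (hqm : Measurable q) (hqi : Integrable q) :
    ∫ φ : Fin (n + 1) → ℝ, min (gibbsWeight J lam φ) (q φ)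
      ≤ ∫ φ, min (gibbsWeight J lam φ) ((q φ + q (-φ)) / 2) := by
  haveI := isNegInvariant_volume_pi (Λ := Fin (n + 1))
  exact symmetrised_overlap_ge (μ := volume) (σ := fun ψ : Fin (n + 1) → ℝ => -ψ)
    (Measure.measurePreserving_neg volume) (fun φ => neg_neg φ) (fun φ => gibbsWeight_pos J lam φ)
    (continuous_gibbsWeight J lam).measurable (fun φ => gibbsWeight_neg J lam φ) hq0 hqm hqi

end Lattice

end Summit.Ventures.LatticeQCDFlow.Exactness
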